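import Summits.QuantumFields.BalabanUV.Beta.EriceFlowEnclosureB12AsPrintedPointwiseFadingEventualAF
import Summits.QuantumFields.BalabanUV.Gaps.CapAvgAFNecessary

/-!
# Beta / EriceFlowEnclosureB12AsPrintedPointwiseFadingEventualAFWitness — WHAT (0.31) FORCES, part 10d: NE4 IS LOAD-BEARING IN PART 10b.  The gaps cell's ALTERNATING family
# `Gaps.CapFloorNotNecessary.altBeta` (β_{k+1}(g_0,…,g_k) = g_k at even k, = 2 at odd k; seat g1-p3) satisfies EVERY hypothesis of part 10b's kernel `eventualLowerH_of_runs_NE4` EXCEPT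
# NE4 — node U2's coupling-chart moduli (last-only, `HistLipschitz (diag 1)` with `FadingMemory 1 θ` for any θ ≥ 0), and for every depth a run of (0.20) in a box with the discrete two-sided
# (0.31) at fixed slopes (read off the gaps cell's `modelOf_alt_thm2Printed` BY NAME) — and part 10's conclusion (`betaAvgAFH_alt`: crew CAP's carrier on every box), yet it has NO eventual
# pointwise floor on any box (`not_eventualLowerH_alt`) and NO scale-shift rate θ < 1 (consecutive β-functions differ by ≥ 1 at every even scale).  So in part 10b the letter NE4 cannot be
# dropped, and what survives without it is exactly part 10's averaged carrier — the gaps cell's `carrier_thm2_not_eventualFloor` read against part 10b's binder list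
# (β-flow team, prover 2 = lower ∕ positivity side, unit `b2b-balaban-beta-bflow-p2`, gen 46; ROW AP-I × node U2's letters; witness side of parts 10 ∕ 10b; the family is the gaps cell's, credited)

HONEST FRAMING (page 1 of everything the β sub-cell writes): discharging `BetaPertH` makes Bałaban's UV stability UNCONDITIONAL — a
real constructive-QFT result; it is NOT the continuum limit and NOT the Clay problem.  HONEST DEPENDENCY (cell reorg 2026-08-19,
verbatim): «continuum YM on T⁴ ⇐ BetaPertH ∧ nine spine estimates (0/9 proved); BetaPertH ⇐ (D1) ∧ (D4) ∧ CAP+tail; G-an2-4 gates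
asym, D1 and NE2/3/4.»  THIS MODULE DISCHARGES NOTHING: a TOY family (the gaps cell's `altBeta`, NOT Bałaban's β) checked against node U2's HYPOTHESIS SHAPES
`T4CouplingMatching.HistLipschitz ∕ FadingMemory ∕ ScaleShiftRate ∕ EventualLowerH` (NONE printed; GAPS G-t4-U2-1 ∕ -2) and the displayed run hypothesis of part 10; the typed Theorem 2
([Balaban1987RG1] Thm 2 p. 259, STATED WITHOUT PROOF) enters only as the gaps cell's theorem ABOUT THE TOY (`modelOf_alt_thm2Printed`).  Nothing of Bałaban's objects is asserted.

WHAT THIS FILE PROVES (0 sorry, 0 def): §1 `lastOnly_alt` ∕ `histLipschitz_alt` ∕ `fadingMemory_alt` (the moduli for the toy), **`runs_alt`** (part 10's run family for the toy: ∃ γ ∈ ]0,1],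
0 < s ≤ s′, one (0.31)-run per depth), **`not_scaleShiftRate_alt`** (¬NE4 for every c and every 0 ≤ θ < 1 on every box ⊆ ]0,1]); §2 **`NE4_loadBearing`** (schema: part 10b's kernel with NE4 deleted is
FALSE — all its other hypotheses hold for the toy on a box, with the smallness, yet `¬ EventualLowerH b δ′ k₀` for every b > 0, δ′ > 0, k₀), `carrier_without_eventualFloor` (the carrier + the moduli on every box, no eventual floor: NE4 is what part 10b §2b adds).
NOT CLAIMED: anything about Bałaban's β; Theorem 2; `BetaPertH`; continuum; Clay.
-/

namespace Summit.QuantumFields.BalabanUV.Beta.EriceFlowEnclosureB12AsPrintedPointwiseFadingEventualAFWitness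

open Finset
open Literature.MathematicalPhysics.QuantumFieldTheory.Balaban1983to89
open Literature.MathematicalPhysics.QuantumFieldTheory.Balaban1983to89.FlowStep (HBeta prefixOf Box mem_box box_mono RGEqH)
open Literature.MathematicalPhysics.QuantumFieldTheory.Balaban1983to89.FlowStepRuns (modelOf genSeq genFlow rgEqH_of_inInterval modelOf_forwardGenerated
  modelOf_haltsOutside modelOf_curries)
open Literature.MathematicalPhysics.QuantumFieldTheory.Balaban1983to89.T4CouplingMatching (HistLipschitz FadingMemory ScaleShiftRate EventualLowerH
  LastOnlyLipschitz histLipschitz_of_lastOnly fadingMemory_diag)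
open Literature.MathematicalPhysics.QuantumFieldTheory.Balaban1983to89.Beta.AveragedAFCarrier (BetaAvgAFH)
open Summit.QuantumFields.BalabanUV.Gaps.CapFloorNotNecessary (altBeta modelOf_alt_thm2Printed)
open Summit.QuantumFields.BalabanUV.Gaps.CapAvgAFNecessary (not_eventualLowerH_alt betaAvgAFH_alt)
open Summit.QuantumFields.BalabanUV.Beta.EriceFlowEnclosureB12AsPrintedPointwiseFadingEventualAF

noncomputable section

/-! ## §1 The alternating family against part 10b's binder list -/

/-- The alternating family is last-only Lipschitz with constant 1 on every box. [folklore] -/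
theorem lastOnly_alt (γ : ℝ) : LastOnlyLipschitz 1 γ altBeta := by
  intro k p q _ _
  unfold Summit.QuantumFields.BalabanUV.Gaps.CapFloorNotNecessary.altBeta
  split_ifs
  · rw [one_mul]
  · simp

/-- Hence node U2's history moduli with the diagonal modulus `Λ k i = [i = k]`. [folklore] -/
theorem histLipschitz_alt (γ : ℝ) : HistLipschitz (fun k i => if i = k then (1 : ℝ) else 0) γ altBeta :=
  histLipschitz_of_lastOnly (lastOnly_alt γ)

/-- … whose memory fades with constant 1 at ANY rate θ ≥ 0 (node U2's `fadingMemory_diag`). [folklore] -/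
theorem fadingMemory_alt {θ : ℝ} (hθ : 0 ≤ θ) : FadingMemory 1 θ (fun k i => if i = k then (1 : ℝ) else 0) :=
  fadingMemory_diag zero_le_one hθ

/-- **PART 10's RUN HYPOTHESIS FOR THE TOY.**  From the gaps cell's `modelOf_alt_thm2Printed` (the typed Theorem 2 for the canonical forward-generated construction of `altBeta`, L = 2) at
ONE endpoint: a box `0 < γ ≤ 1`, slopes `0 < s ≤ s′` and for every depth K a run of (0.20) in ]0, γ] with `Step.Discrete031 s s′ K (r_K) r` (`FlowStepRuns.rgEqH_of_inInterval` for (0.20)).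
[cite: Balaban1987RG1, Thm 2 (0.31) p.259 with (0.20) p.256] -/
theorem runs_alt : ∃ γ s s' : ℝ, 0 < γ ∧ γ ≤ 1 ∧ 0 < s ∧ s ≤ s' ∧
    ∀ K : ℕ, ∃ r : ℕ → ℝ, RGEqH K altBeta r ∧ Step.InInterval γ K r ∧ Step.Discrete031 s s' K (r K) r := by
  have hlog : 0 < Real.log (2 : ℝ) := Real.log_pos (by norm_num)
  obtain ⟨γ₂, hγ₂, hγ⟩ := modelOf_alt_thm2Printed (L := 2) (by norm_num) 0
  obtain ⟨gstar, hgstar, hg⟩ := hγ (min γ₂ 1) (lt_min hγ₂ one_pos) (min_le_left _ _)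
  obtain ⟨β, β', hβ, hββ', hK⟩ := hg gstar hgstar le_rfl
  refine ⟨min γ₂ 1, β * Real.log 2, β' * Real.log 2, lt_min hγ₂ one_pos, min_le_right _ _, mul_pos hβ hlog,
    mul_le_mul_of_nonneg_right hββ' hlog.le, fun K => ?_⟩
  obtain ⟨g₀, hI, hend, h031⟩ := hK K
  refine ⟨(modelOf altBeta ⟨K, 0, g₀⟩).flow.g,
    rgEqH_of_inInterval (modelOf_forwardGenerated altBeta) (modelOf_haltsOutside altBeta) (modelOf_curries altBeta) ⟨K, 0, g₀⟩ hI,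
    fun k hk => hI k hk, fun k hk => ?_⟩
  have h := h031 k hk
  rw [hend]
  constructor <;> nlinarith [h.1, h.2]

/-- **THE TOY HAS NO SCALE-SHIFT RATE θ < 1** on any box ]0, γ] with 0 < γ ≤ 1: at every even scale k the next β-function is ≡ 2 while the current one is the last coupling ≤ 1, so
`|β_{k+2}(w) − β_{k+1}(tail w)| ≥ 1`, which no `cθ^k` with 0 ≤ θ < 1 dominates for all k. [folklore] -/
theorem not_scaleShiftRate_alt {γ c θ : ℝ} (hγ : 0 < γ) (hγ1 : γ ≤ 1) (hθ0 : 0 ≤ θ) (hθ1 : θ < 1) : ¬ ScaleShiftRate c θ γ altBeta := by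
  intro hS
  -- the gap at an even scale 2n
  have hgap : ∀ n : ℕ, 1 ≤ c * θ ^ (2 * n) := by
    intro n
    have hw : (fun _ : Fin (2 * n + 2) => γ) ∈ Box γ (2 * n + 1) := mem_box.mpr fun _ => ⟨hγ, le_rfl⟩
    have h := hS (2 * n) (fun _ => γ) hw
    have h1 : altBeta (2 * n + 1) (fun _ : Fin (2 * n + 2) => γ) = 2 := by
      simp [Summit.QuantumFields.BalabanUV.Gaps.CapFloorNotNecessary.altBeta]
    have h2 : altBeta (2 * n) (Fin.tail (fun _ : Fin (2 * n + 2) => γ)) = γ := by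
      simp [Summit.QuantumFields.BalabanUV.Gaps.CapFloorNotNecessary.altBeta, Fin.tail]
    rw [h1, h2] at h
    have : (1 : ℝ) ≤ |2 - γ| := by rw [abs_of_pos (by linarith)]; linarith
    exact this.trans h
  have hc : 0 < c := by
    have h0 := hgap 0
    rw [mul_zero, pow_zero, mul_one] at h0
    linarith
  -- θ^{2n} = (θ²)^n → 0
  have hθ2 : θ ^ 2 < 1 := by nlinarith
  obtain ⟨n, hn⟩ := exists_pow_lt_of_lt_one (show 0 < 1 / c by positivity) hθ2
  have h := hgap n
  rw [pow_mul] at h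
  have : c * (θ ^ 2) ^ n < c * (1 / c) := mul_lt_mul_of_pos_left hn hc
  rw [mul_one_div_cancel hc.ne'] at this
  linarith

/-! ## §2 NE4 is load-bearing in part 10b; part 10's carrier survives -/

/-- **NE4 IS LOAD-BEARING IN PART 10b** (`eventualLowerH_of_runs_NE4` with `ScaleShiftRate` deleted is FALSE as a schema): there are β, a box γ, a diagonal modulus Λ and slopes such that
`HistLipschitz Λ γ β`, `FadingMemory 1 0 Λ` (so every `0 ≤ θ < 1` works), for every depth a run of (0.20) in ]0, γ] with the discrete two-sided (0.31) at slopes `0 < s ≤ s′`, and a box δ ≤ γ with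
the smallness `4·1·δ ≤ s(1−0)` — EVERYTHING part 10b's kernel asks except NE4, which FAILS for every c and every 0 ≤ θ < 1 — and yet `¬ EventualLowerH b δ′ k₀ β` for EVERY b > 0, δ′ > 0, k₀.
The family is the gaps cell's `altBeta`. [folklore] -/
theorem NE4_loadBearing : ∃ (β : HBeta) (γ δ s s' : ℝ) (Λ : ℕ → ℕ → ℝ),
    HistLipschitz Λ γ β ∧ FadingMemory 1 0 Λ ∧ 0 < δ ∧ δ ≤ γ ∧ 0 < s ∧ s ≤ s' ∧ 4 * 1 * δ ≤ s * (1 - 0) ∧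
    (∀ K : ℕ, ∃ r : ℕ → ℝ, RGEqH K β r ∧ Step.InInterval γ K r ∧ Step.Discrete031 s s' K (r K) r) ∧
    (∀ c θ : ℝ, 0 ≤ θ → θ < 1 → ¬ ScaleShiftRate c θ γ β) ∧
    ∀ b δ' : ℝ, 0 < b → 0 < δ' → ∀ k₀ : ℕ, ¬ EventualLowerH b δ' k₀ β := by
  obtain ⟨γ, s, s', hγ, hγ1, hs, hss', hruns⟩ := runs_alt
  refine ⟨altBeta, γ, min γ (s / 4), s, s', fun k i => if i = k then (1 : ℝ) else 0, histLipschitz_alt γ, fadingMemory_alt le_rfl,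
    lt_min hγ (by positivity), min_le_left _ _, hs, hss', ?_, hruns, fun c θ hθ0 hθ1 => not_scaleShiftRate_alt hγ hγ1 hθ0 hθ1,
    fun b δ' hb hδ' k₀ => not_eventualLowerH_alt hb hδ' k₀⟩
  have := min_le_right γ (s / 4)
  linarith

/-- **THE SEPARATION IN ONE LINE**: a family carrying crew CAP's averaged carrier on EVERY box (the gaps cell's `betaAvgAFH_alt`: slope 1, defect 1 — part 10's conclusion, which does not use NE4)
and yet NO eventual pointwise floor on ANY box — so «`BetaAvgAFH` + moduli ⟹ `EventualLowerH` near zero» needs NE4 (part 10b §2b `eventualLowerH_of_betaAvgAFH_NE4` has it). [folklore] -/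
theorem carrier_without_eventualFloor :
    ∃ β : HBeta, (∀ γ : ℝ, BetaAvgAFH 1 1 γ β) ∧ (∀ γ : ℝ, HistLipschitz (fun k i => if i = k then (1 : ℝ) else 0) γ β) ∧
      (∀ θ : ℝ, 0 ≤ θ → FadingMemory 1 θ (fun k i => if i = k then (1 : ℝ) else 0)) ∧
      ∀ b δ' : ℝ, 0 < b → 0 < δ' → ∀ k₀ : ℕ, ¬ EventualLowerH b δ' k₀ β :=
  ⟨altBeta, betaAvgAFH_alt, histLipschitz_alt, fun _ hθ => fadingMemory_alt hθ, fun _ _ hb hδ' k₀ => not_eventualLowerH_alt hb hδ' k₀⟩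

end

end Summit.QuantumFields.BalabanUV.Beta.EriceFlowEnclosureB12AsPrintedPointwiseFadingEventualAFWitness
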